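import Mathlib
import Literature.Analysis.UnboundedOperators.HeatKernelDirichletForm
import Literature.Analysis.UnboundedOperators.HeatKernelPoincare
import Literature.Analysis.UnboundedOperators.HeatKernelGradient
import Literature.Analysis.FluidPDE.WholeSpaceIBPIntegrable
import Literature.Analysis.FluidPDE.EnstrophySplitting
import Literature.Analysis.FluidPDE.SteadyLiouvilleTsaiVorticity
import Summits.NavierStokesRegularity.NavierStokesRegularity.Theorems.DssFarFieldSlavingBlowupTypeIDssProfileGaussianIBP
import HarnessLib

/-!
# Gaussian (heat-kernel weighted) identities for vector fields on `ℝ³`: transport, Ornstein–Uhlenbeck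
  Dirichlet form, Poincaré — file 1 of the Gaussian-gap Liouville theorem (pub-ns-dss theory T41 /
  cell E32; route `DssFarFieldSlaving`, crux `BlowupTypeIDssProfile`, stmt-NavierStokesRegularity-0155 —
  SUPPORT; cell pub-ns-dss, typer seat g4, 2026-08-23; lead A129 precision 4 (b): file (1) GO)

HONEST FRAMING. Bookkeeping only: three weighted identities/inequalities for smooth bounded vector fields
on `ℝ³` against the unit-time heat kernel `K = heatKernel 1 = (4π)^{−3/2} e^{−|y|²/4}` (the Gaussian
weight of the backward similarity variables), each a corollary of a PROVED tree theorem. Nothing here is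
about Navier–Stokes; nothing here is an exclusion; no new mathematics.

* `integral_heatKernel_inner_convect` — TRANSPORT: for `div U = 0`,
  `∫ K ⟪DΩ[U], Ω⟫ = ¼ ∫ K ⟪y, U⟫ |Ω|²` (whole-space integration by parts
  `integral_mul_divergence_add_eq_zero_of_integrable` with `θ = |Ω|²`, `u = K U`, `∇K = −½ y K`; the tree's
  `integral_gaussian_inner_convect_self` is the compactly supported version).
* `integral_heatKernel_inner_laplacian_sub_half_fderiv` — ORNSTEIN–UHLENBECK DIRICHLET FORM:
  `∫ K ⟪ΔΩ − ½ DΩ[y], Ω⟫ = −Σᵢ ∫ K ‖D Ωᵢ‖²` (the tree's scalar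
  `integral_ornsteinUhlenbeck_mul_mul_heatKernel` at `t = 1`, componentwise).
* `integral_heatKernel_norm_sq_sub_norm_sq_integral_le` — GAUSSIAN POINCARÉ for vector fields:
  `∫ K |Ω|² − |∫ K Ω|² ≤ 2 Σᵢ ∫ K ‖D Ωᵢ‖²` (the tree's sharp scalar `sq_integral_heatKernel_poincare`
  at `t = 1`, summed over components; gap `½` of `Δ − ½ y·∇`).
Used by the next file for the Gaussian-enstrophy inequality `½ Z′ ≤ −(3/2 − Λ − ¼P₋ − ½μ) Z` of the
cell's theory seat (EXPLICIT-THRESHOLDS T41; statement file GaussianGapStatements.lean 7c27e69b80687da9).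
[cite: GallayWayne2005, §4.1.3 and Lemma 4.7 (forward twin)]
-/

noncomputable section

set_option linter.dupNamespace false

namespace Summit.NavierStokesRegularity.NavierStokesRegularity.Theorems.GaussianGap

open Set Function Filter MeasureTheory InnerProductSpace Real
open scoped RealInnerProductSpace Laplacian ContDiff Topology BigOperators
open Literature.Analysis Literature.Analysis.FluidPDE Literature.Analysis.FluidPDE.PineauVicol2026
open Literature.Analysis.UnboundedOperators
open Summit.NavierStokesRegularity.NavierStokesRegularity.Theorems
open Summit.NavierStokesRegularity.NavierStokesRegularity.Theorems.GaussianHeadPressure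

/-! ### The unit-time heat kernel on `ℝ³` -/

/-- `heatKernel 1 = (4π)^{−3/2} γ` on `ℝ³`, `γ(y) = e^{−|y|²/4}` the tree's `gaussWeight`. [folklore] -/
theorem heatKernel_one_eq_gaussWeight (y : EuclideanSpace ℝ (Fin 3)) :
    heatKernel 1 y = (4 * π) ^ (-(3 : ℝ) / 2) * gaussWeight y := by
  simp only [heatKernel, gaussWeight, finrank_euclideanSpace_fin, mul_one]
  norm_num

/-- The unit-time heat kernel is positive. [folklore] -/
theorem heatKernel_one_pos (y : EuclideanSpace ℝ (Fin 3)) : 0 < heatKernel 1 y :=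
  heatKernel_pos one_pos y

/-- `∇K(y) = −½ K(y) y` for `K = heatKernel 1`. [folklore] -/
theorem gradient_heatKernel_one (y : EuclideanSpace ℝ (Fin 3)) :
    gradient (heatKernel (E := EuclideanSpace ℝ (Fin 3)) 1) y = (-(1 / 2 : ℝ) * heatKernel 1 y) • y := by
  apply ext_inner_right ℝ
  intro v
  rw [inner_gradient_left, (hasFDerivAt_heatKernel 1 y).fderiv, real_inner_smul_left]
  rw [show (((-(heatKernel 1 y / (2 * 1))) • innerSL ℝ y : EuclideanSpace ℝ (Fin 3) →L[ℝ] ℝ) v) =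
      (-(heatKernel 1 y / (2 * 1))) * ⟪y, v⟫ from rfl]
  ring

/-- Integrability on `ℝ³` of a continuous function dominated by `C (1+|y|)ᴺ K(y)`. [folklore] -/
theorem integrable_of_le_poly_heatKernel {F : Type*} [NormedAddCommGroup F]
    {f : EuclideanSpace ℝ (Fin 3) → F} (hf : Continuous f) {C : ℝ} {N : ℕ}
    (h : ∀ y, ‖f y‖ ≤ C * (1 + ‖y‖) ^ N * heatKernel 1 y) : Integrable f := by
  refine integrable_of_le_poly_gaussWeight hf (K := C * (4 * π) ^ (-(3 : ℝ) / 2)) (N := N) fun y => ?_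
  have := h y
  rw [heatKernel_one_eq_gaussWeight] at this
  calc ‖f y‖ ≤ C * (1 + ‖y‖) ^ N * ((4 * π) ^ (-(3 : ℝ) / 2) * gaussWeight y) := this
    _ = C * (4 * π) ^ (-(3 : ℝ) / 2) * (1 + ‖y‖) ^ N * gaussWeight y := by ring

/-! ### Transport -/

/-- **Gaussian transport identity (whole space).** For `U ∈ C¹` divergence free and bounded and
`Ω ∈ C¹` bounded with bounded derivative,
`∫ K ⟪DΩ(y)[U(y)], Ω(y)⟫ dy = ¼ ∫ K ⟪y, U(y)⟫ |Ω(y)|² dy`, `K = heatKernel 1`: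
the drift `(U·∇)` costs exactly the radial flux `y·U` against the Gaussian (`∇K = −½ y K`).
[cite: GallayWayne2005, §4.1.3 and Lemma 4.7 (forward twin)] -/
theorem integral_heatKernel_inner_convect {C : ℝ}
    {U Ω : EuclideanSpace ℝ (Fin 3) → EuclideanSpace ℝ (Fin 3)} (hU : ContDiff ℝ 1 U)
    (hΩ : ContDiff ℝ 1 Ω) (hdiv : VectorCalculus.IsDivFree U) (hUb : ∀ y, ‖U y‖ ≤ C)
    (hΩb : ∀ y, ‖Ω y‖ ≤ C) (hDΩb : ∀ y, ‖fderiv ℝ Ω y‖ ≤ C) :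
    ∫ y, heatKernel 1 y * ⟪fderiv ℝ Ω y (U y), Ω y⟫ =
      (1 / 4 : ℝ) * ∫ y, heatKernel 1 y * (⟪y, U y⟫ * ‖Ω y‖ ^ 2) := by
  have hC : 0 ≤ C := (norm_nonneg _).trans (hUb 0)
  have hK1 : ContDiff ℝ 1 (heatKernel (E := EuclideanSpace ℝ (Fin 3)) 1) := by
    have e : heatKernel (E := EuclideanSpace ℝ (Fin 3)) 1 = fun x =>
        (4 * π * 1) ^ (-(Module.finrank ℝ (EuclideanSpace ℝ (Fin 3)) : ℝ) / 2) *
          Real.exp (-‖x‖ ^ 2 / (4 * 1)) := rfl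
    rw [e]
    exact contDiff_const.mul (Real.contDiff_exp.comp ((contDiff_norm_sq ℝ).neg.div_const _))
  have hKd : Differentiable ℝ (heatKernel (E := EuclideanSpace ℝ (Fin 3)) 1) :=
    hK1.differentiable one_ne_zero
  have hUd : Differentiable ℝ U := hU.differentiable one_ne_zero
  have hΩd : Differentiable ℝ Ω := hΩ.differentiable one_ne_zero
  -- `θ = |Ω|²`
  have hθ : ContDiff ℝ 1 fun y => ‖Ω y‖ ^ 2 := hΩ.norm_sq ℝ
  have hθd : ∀ y, HasFDerivAt (fun y => ‖Ω y‖ ^ 2) (2 • (innerSL ℝ (Ω y)).comp (fderiv ℝ Ω y)) y :=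
    fun y => (hΩd y).hasFDerivAt.norm_sq
  have hgradθ : ∀ y v, ⟪v, gradient (fun y => ‖Ω y‖ ^ 2) y⟫ = 2 * ⟪Ω y, fderiv ℝ Ω y v⟫ := by
    intro y v
    rw [real_inner_comm, inner_gradient_left, (hθd y).fderiv]
    simp [two_smul]
    ring
  -- the divergence of `K U`
  have hdivKU : ∀ y, VectorCalculus.divergence (fun z => heatKernel 1 z • U z) y =
      -(1 / 2 : ℝ) * heatKernel 1 y * ⟪y, U y⟫ := by
    intro y
    rw [divergence_smul_apply (hKd y) (hUd y), hdiv y, mul_zero, zero_add, gradient_heatKernel_one,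
      real_inner_smul_right, real_inner_comm]
  -- continuity
  have cK : Continuous (heatKernel (E := EuclideanSpace ℝ (Fin 3)) 1) := continuous_heatKernel 1
  have cU : Continuous U := hU.continuous
  have cΩ : Continuous Ω := hΩ.continuous
  have cDΩ : Continuous (fderiv ℝ Ω) := hΩ.continuous_fderiv one_ne_zero
  have cgθ : Continuous (gradient fun y => ‖Ω y‖ ^ 2) :=
    (PineauVicol2026.contDiff_gradient (n := 0) (by simpa using hθ)).continuous
  -- integrability
  have i0 : Integrable fun y => ‖Ω y‖ ^ 2 • (heatKernel 1 y • U y) := by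
    refine integrable_of_le_poly_heatKernel ((cΩ.norm.pow 2).smul (cK.smul cU)) (C := C ^ 2 * C)
      (N := 0) fun y => ?_
    rw [norm_smul, norm_smul, Real.norm_eq_abs, Real.norm_eq_abs, abs_of_nonneg (by positivity),
      abs_of_pos (heatKernel_one_pos y), pow_zero, mul_one]
    have h1 : ‖Ω y‖ ^ 2 ≤ C ^ 2 := pow_le_pow_left₀ (norm_nonneg _) (hΩb y) 2
    have hK0 := (heatKernel_one_pos y).le
    calc ‖Ω y‖ ^ 2 * (heatKernel 1 y * ‖U y‖) ≤ C ^ 2 * (heatKernel 1 y * C) :=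
          mul_le_mul h1 (mul_le_mul_of_nonneg_left (hUb y) hK0) (by positivity) (by positivity)
      _ = C ^ 2 * C * heatKernel 1 y := by ring
  have i1 : Integrable fun y => ‖Ω y‖ ^ 2 *
      VectorCalculus.divergence (fun z => heatKernel 1 z • U z) y := by
    simp_rw [hdivKU]
    refine integrable_of_le_poly_heatKernel ((cΩ.norm.pow 2).mul ((continuous_const.mul cK).mul
      (continuous_id.inner cU))) (C := C ^ 2 * ((1 / 2) * C)) (N := 1) fun y => ?_
    rw [Real.norm_eq_abs, abs_mul, abs_mul, abs_mul, abs_of_nonneg (by positivity : (0:ℝ) ≤ ‖Ω y‖ ^ 2),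
      abs_of_pos (heatKernel_one_pos y), abs_neg, abs_of_pos (by norm_num : (0:ℝ) < 1 / 2)]
    have h1 : ‖Ω y‖ ^ 2 ≤ C ^ 2 := pow_le_pow_left₀ (norm_nonneg _) (hΩb y) 2
    have h2 : |⟪y, U y⟫| ≤ (1 + ‖y‖) * C := (abs_real_inner_le_norm _ _).trans
      (mul_le_mul (by linarith [norm_nonneg y]) (hUb y) (norm_nonneg _) (by linarith [norm_nonneg y]))
    have hK0 := (heatKernel_one_pos y).le
    calc ‖Ω y‖ ^ 2 * ((1 / 2 : ℝ) * heatKernel 1 y * |⟪y, U y⟫|)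
        ≤ C ^ 2 * ((1 / 2 : ℝ) * heatKernel 1 y * ((1 + ‖y‖) * C)) :=
          mul_le_mul h1 (mul_le_mul_of_nonneg_left h2 (by positivity)) (by positivity) (by positivity)
      _ = C ^ 2 * ((1 / 2) * C) * (1 + ‖y‖) ^ 1 * heatKernel 1 y := by ring
  have i2 : Integrable fun y => ⟪heatKernel 1 y • U y, gradient (fun y => ‖Ω y‖ ^ 2) y⟫ := by
    have e : (fun y => ⟪heatKernel 1 y • U y, gradient (fun y => ‖Ω y‖ ^ 2) y⟫) =
        fun y => heatKernel 1 y * (2 * ⟪Ω y, fderiv ℝ Ω y (U y)⟫) := by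
      funext y; rw [real_inner_smul_left, hgradθ]
    rw [e]
    refine integrable_of_le_poly_heatKernel (cK.mul (continuous_const.mul (cΩ.inner (cDΩ.clm_apply cU))))
      (C := 2 * (C * (C * C))) (N := 0) fun y => ?_
    rw [Real.norm_eq_abs, abs_mul, abs_of_pos (heatKernel_one_pos y), pow_zero, mul_one, abs_mul,
      abs_of_pos (by norm_num : (0:ℝ) < 2)]
    have h1 : |⟪Ω y, fderiv ℝ Ω y (U y)⟫| ≤ C * (C * C) :=
      (abs_real_inner_le_norm _ _).trans (mul_le_mul (hΩb y)
        ((ContinuousLinearMap.le_opNorm _ _).trans (mul_le_mul (hDΩb y) (hUb y) (norm_nonneg _) hC))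
        (norm_nonneg _) hC)
    have hK0 := (heatKernel_one_pos y).le
    calc heatKernel 1 y * (2 * |⟪Ω y, fderiv ℝ Ω y (U y)⟫|) ≤ heatKernel 1 y * (2 * (C * (C * C))) :=
          mul_le_mul_of_nonneg_left (mul_le_mul_of_nonneg_left h1 (by norm_num)) hK0
      _ = 2 * (C * (C * C)) * heatKernel 1 y := by ring
  have key := integral_mul_divergence_add_eq_zero_of_integrable (θ := fun y => ‖Ω y‖ ^ 2)
    (u := fun z => heatKernel 1 z • U z) hθ (hK1.smul hU) i0 i1 i2
  have e1 : (fun y => ‖Ω y‖ ^ 2 * VectorCalculus.divergence (fun z => heatKernel 1 z • U z) y) =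
      fun y => -(1 / 2 : ℝ) * (heatKernel 1 y * (⟪y, U y⟫ * ‖Ω y‖ ^ 2)) := by
    funext y; rw [hdivKU y]; ring
  have e2 : (fun y => ⟪heatKernel 1 y • U y, gradient (fun y => ‖Ω y‖ ^ 2) y⟫) =
      fun y => 2 * (heatKernel 1 y * ⟪fderiv ℝ Ω y (U y), Ω y⟫) := by
    funext y; rw [real_inner_smul_left, hgradθ, real_inner_comm]; ring
  rw [e1, e2, integral_const_mul, integral_const_mul] at key
  linarith

/-! ### Ornstein–Uhlenbeck Dirichlet form -/

/-- `|vᵢ| ≤ |v|` on `ℝ³`. [folklore] -/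
private theorem norm_apply_le_norm (v : EuclideanSpace ℝ (Fin 3)) (i : Fin 3) : ‖v i‖ ≤ ‖v‖ :=
  PiLp.norm_apply_le v i

/-- Components of a bounded field are bounded: `|Ωᵢ| ≤ |Ω| ≤ C`. [folklore] -/
theorem norm_coord_le {Ω : EuclideanSpace ℝ (Fin 3) → EuclideanSpace ℝ (Fin 3)} {C : ℝ}
    (hΩb : ∀ y, ‖Ω y‖ ≤ C) (i : Fin 3) (y : EuclideanSpace ℝ (Fin 3)) : ‖Ω y i‖ ≤ C :=
  (norm_apply_le_norm (Ω y) i).trans (hΩb y)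

/-- The derivative of a component is the component of the derivative:
`D(Ωᵢ)(y) = πᵢ ∘ DΩ(y)`. [folklore] -/
theorem fderiv_coord_eq {Ω : EuclideanSpace ℝ (Fin 3) → EuclideanSpace ℝ (Fin 3)}
    {y : EuclideanSpace ℝ (Fin 3)} (hΩ : DifferentiableAt ℝ Ω y) (i : Fin 3) :
    fderiv ℝ (fun z => Ω z i) y =
      (EuclideanSpace.proj i : EuclideanSpace ℝ (Fin 3) →L[ℝ] ℝ).comp (fderiv ℝ Ω y) :=
  ((EuclideanSpace.proj i : EuclideanSpace ℝ (Fin 3) →L[ℝ] ℝ).hasFDerivAt.comp y hΩ.hasFDerivAt).fderiv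

/-- `D(Ωᵢ)(y)[v] = (DΩ(y)[v])ᵢ`. [folklore] -/
theorem fderiv_coord_apply {Ω : EuclideanSpace ℝ (Fin 3) → EuclideanSpace ℝ (Fin 3)}
    {y : EuclideanSpace ℝ (Fin 3)} (hΩ : DifferentiableAt ℝ Ω y) (i : Fin 3) (v : EuclideanSpace ℝ (Fin 3)) :
    fderiv ℝ (fun z => Ω z i) y v = fderiv ℝ Ω y v i := by
  rw [fderiv_coord_eq hΩ i]; rfl

/-- The coordinate projections of `ℝ³` have operator norm `≤ 1`. [folklore] -/
theorem norm_proj_le_one (i : Fin 3) :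
    ‖(EuclideanSpace.proj i : EuclideanSpace ℝ (Fin 3) →L[ℝ] ℝ)‖ ≤ 1 :=
  ContinuousLinearMap.opNorm_le_bound _ zero_le_one fun v => by
    rw [one_mul]; exact norm_apply_le_norm v i

/-- `‖D(Ωᵢ)(y)‖ ≤ ‖DΩ(y)‖`. [folklore] -/
theorem norm_fderiv_coord_le {Ω : EuclideanSpace ℝ (Fin 3) → EuclideanSpace ℝ (Fin 3)}
    {y : EuclideanSpace ℝ (Fin 3)} (hΩ : DifferentiableAt ℝ Ω y) (i : Fin 3) :
    ‖fderiv ℝ (fun z => Ω z i) y‖ ≤ ‖fderiv ℝ Ω y‖ := by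
  rw [fderiv_coord_eq hΩ i]
  calc ‖(EuclideanSpace.proj i : EuclideanSpace ℝ (Fin 3) →L[ℝ] ℝ).comp (fderiv ℝ Ω y)‖
      ≤ ‖(EuclideanSpace.proj i : EuclideanSpace ℝ (Fin 3) →L[ℝ] ℝ)‖ * ‖fderiv ℝ Ω y‖ :=
        ContinuousLinearMap.opNorm_comp_le _ _
    _ ≤ 1 * ‖fderiv ℝ Ω y‖ := mul_le_mul_of_nonneg_right (norm_proj_le_one i) (norm_nonneg _)
    _ = ‖fderiv ℝ Ω y‖ := one_mul _

/-- Second derivatives of a component are bounded by those of the field: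
`‖D(DΩᵢ)(y)‖ ≤ ‖D²Ω(y)‖` (iterated-derivative form on the right). [folklore] -/
theorem norm_fderiv_fderiv_coord_le {Ω : EuclideanSpace ℝ (Fin 3) → EuclideanSpace ℝ (Fin 3)}
    (hΩ : ContDiff ℝ 2 Ω) {C : ℝ} (h2 : ∀ y, ‖iteratedFDeriv ℝ 2 Ω y‖ ≤ C) (i : Fin 3)
    (y : EuclideanSpace ℝ (Fin 3)) : ‖fderiv ℝ (fderiv ℝ (fun z => Ω z i)) y‖ ≤ C := by
  have h : (fun z => Ω z i) = (EuclideanSpace.proj i : EuclideanSpace ℝ (Fin 3) →L[ℝ] ℝ) ∘ Ω := rfl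
  rw [← norm_iteratedFDeriv_one (fderiv ℝ (fun z => Ω z i)), norm_iteratedFDeriv_fderiv, h,
    ContinuousLinearMap.iteratedFDeriv_comp_left _ hΩ.contDiffAt le_rfl]
  calc ‖(EuclideanSpace.proj i : EuclideanSpace ℝ (Fin 3) →L[ℝ] ℝ).compContinuousMultilinearMap
        (iteratedFDeriv ℝ 2 Ω y)‖
      ≤ ‖(EuclideanSpace.proj i : EuclideanSpace ℝ (Fin 3) →L[ℝ] ℝ)‖ * ‖iteratedFDeriv ℝ 2 Ω y‖ :=
        ContinuousLinearMap.norm_compContinuousMultilinearMap_le _ _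
    _ ≤ 1 * C := mul_le_mul (norm_proj_le_one i) (h2 y) (norm_nonneg _) zero_le_one
    _ = C := one_mul C

/-- **The Ornstein–Uhlenbeck Dirichlet-form identity for vector fields (whole space).** For
`Ω ∈ C²(ℝ³; ℝ³)` with `Ω`, `DΩ`, `D²Ω` bounded and `K = heatKernel 1`,
`∫ K ⟪ΔΩ(y) − ½ DΩ(y)[y], Ω(y)⟫ dy = −Σᵢ ∫ K ‖DΩᵢ(y)‖² dy`: the drift Laplacian `Δ − ½ y·∇` of the
backward similarity variables is symmetric and non-positive on `L²(K dy)` (the tree's scalar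
`integral_ornsteinUhlenbeck_mul_mul_heatKernel`, `t = 1`, applied to each component).
[cite: GallayWayne2005, §4.1.3 and Lemma 4.7 (forward twin)] -/
theorem integral_heatKernel_inner_laplacian_sub_half_fderiv {C : ℝ}
    {Ω : EuclideanSpace ℝ (Fin 3) → EuclideanSpace ℝ (Fin 3)} (hΩ : ContDiff ℝ 2 Ω)
    (hΩb : ∀ y, ‖Ω y‖ ≤ C) (hDΩb : ∀ y, ‖fderiv ℝ Ω y‖ ≤ C) (hD2Ωb : ∀ y, ‖iteratedFDeriv ℝ 2 Ω y‖ ≤ C) :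
    ∫ y, heatKernel 1 y * ⟪(Δ Ω) y - (1 / 2 : ℝ) • fderiv ℝ Ω y y, Ω y⟫ =
      -∑ i, ∫ y, heatKernel 1 y * ‖fderiv ℝ (fun z => Ω z i) y‖ ^ 2 := by
  have hΩd : Differentiable ℝ Ω := hΩ.differentiable (by norm_num)
  have hci : ∀ i : Fin 3, ContDiff ℝ 2 (fun z => Ω z i) := fun i =>
    (EuclideanSpace.proj i : EuclideanSpace ℝ (Fin 3) →L[ℝ] ℝ).contDiff.comp hΩ
  -- the integrand in coordinates
  have hpt : ∀ y, heatKernel 1 y * ⟪(Δ Ω) y - (1 / 2 : ℝ) • fderiv ℝ Ω y y, Ω y⟫ =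
      ∑ i, (Δ (fun z => Ω z i) y - (2 * (1:ℝ))⁻¹ * fderiv ℝ (fun z => Ω z i) y y) * Ω y i *
        heatKernel 1 y := by
    intro y
    rw [real_inner_comm, PiLp.inner_apply, Finset.mul_sum]
    refine Finset.sum_congr rfl fun i _ => ?_
    simp only [RCLike.inner_apply, conj_trivial, PiLp.sub_apply, PiLp.smul_apply, smul_eq_mul,
      Tsai2021.laplacian_apply_coord hΩ y i, ← fderiv_coord_apply (hΩd y) i y]
    ring
  simp_rw [hpt]
  -- each summand is integrable; swap sum and integral
  have hint : ∀ i : Fin 3, Integrable fun y =>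
      (Δ (fun z => Ω z i) y - (2 * (1:ℝ))⁻¹ * fderiv ℝ (fun z => Ω z i) y y) * Ω y i * heatKernel 1 y := by
    intro i
    have c1 : Continuous (Δ (fun z => Ω z i)) := continuous_laplacian (hci i)
    have c2 : Continuous fun y => fderiv ℝ (fun z => Ω z i) y y :=
      ((hci i).continuous_fderiv (by norm_num)).clm_apply continuous_id
    have c3 : Continuous fun y => Ω y i := (hci i).continuous
    refine integrable_of_le_poly_heatKernel (((c1.sub (continuous_const.mul c2)).mul c3).mul
      (continuous_heatKernel 1)) (C := (3 * C + (1 / 2) * C) * C) (N := 1) fun y => ?_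
    rw [Real.norm_eq_abs, abs_mul, abs_mul, abs_of_pos (heatKernel_one_pos y)]
    have hΔ : |Δ (fun z => Ω z i) y| ≤ 3 * C := by
      have e1 : Δ (fun z => Ω z i) y = (Δ Ω) y i := (Tsai2021.laplacian_apply_coord hΩ y i).symm
      have e2 : ‖(Δ Ω) y i‖ ≤ ‖(Δ Ω) y‖ := norm_apply_le_norm ((Δ Ω) y) i
      have e3 : ‖(Δ Ω) y‖ ≤ 3 * C :=
        (norm_laplacian_le_three_mul_norm_iteratedFDeriv_two hΩ y).trans
          (mul_le_mul_of_nonneg_left (hD2Ωb y) (by norm_num))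
      rw [e1, ← Real.norm_eq_abs]
      exact e2.trans e3
    have hD : |fderiv ℝ (fun z => Ω z i) y y| ≤ C * ‖y‖ := by
      rw [← Real.norm_eq_abs]
      exact (ContinuousLinearMap.le_opNorm _ _).trans (mul_le_mul_of_nonneg_right
        ((norm_fderiv_coord_le (hΩd y) i).trans (hDΩb y)) (norm_nonneg _))
    have h0 : |Ω y i| ≤ C := by rw [← Real.norm_eq_abs]; exact norm_coord_le hΩb i y
    have hC : 0 ≤ C := (norm_nonneg _).trans (hΩb 0)
    have hy : ‖y‖ ≤ 1 + ‖y‖ := by linarith [norm_nonneg y]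
    have hK0 := (heatKernel_one_pos y).le
    have h1 : |Δ (fun z => Ω z i) y - (2 * (1:ℝ))⁻¹ * fderiv ℝ (fun z => Ω z i) y y| ≤
        (3 * C + (1 / 2) * C) * (1 + ‖y‖) := by
      refine (abs_sub _ _).trans ?_
      rw [abs_mul, show |(2 * (1:ℝ))⁻¹| = 1 / 2 by norm_num]
      have : 3 * C ≤ 3 * C * (1 + ‖y‖) := le_mul_of_one_le_right (by positivity) (by linarith [norm_nonneg y])
      nlinarith [hΔ, hD, hy, hC]
    calc |Δ (fun z => Ω z i) y - (2 * (1:ℝ))⁻¹ * fderiv ℝ (fun z => Ω z i) y y| * |Ω y i| * heatKernel 1 y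
        ≤ (3 * C + (1 / 2) * C) * (1 + ‖y‖) * C * heatKernel 1 y :=
          mul_le_mul_of_nonneg_right (mul_le_mul h1 h0 (abs_nonneg _) (by positivity)) hK0
      _ = (3 * C + (1 / 2) * C) * C * (1 + ‖y‖) ^ 1 * heatKernel 1 y := by ring
  rw [integral_finsetSum _ fun i _ => hint i, ← Finset.sum_neg_distrib]
  refine Finset.sum_congr rfl fun i _ => ?_
  have h := integral_ornsteinUhlenbeck_mul_mul_heatKernel one_pos (hci i) (norm_coord_le hΩb i)
    (fun y => (norm_fderiv_coord_le (hΩd y) i).trans (hDΩb y))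
    (norm_fderiv_fderiv_coord_le hΩ hD2Ωb i)
  rw [h]
  congr 1
  refine integral_congr_ae (Eventually.of_forall fun y => ?_)
  simp only [mul_comm]

/-! ### Poincaré -/

/-- **Gaussian Poincaré inequality for vector fields on `ℝ³`** (sharp constant `2`, i.e. spectral
gap `½` of `Δ − ½ y·∇` on `L²(K dy)`, `K = heatKernel 1`): for `Ω ∈ C¹` with `Ω` and `DΩ` bounded,
`∫ K |Ω|² − |∫ K Ω|² ≤ 2 Σᵢ ∫ K ‖DΩᵢ‖²` (the tree's scalar `sq_integral_heatKernel_poincare` at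
`t = 1`, summed over the components; `∫ K = 1`). [cite: GallayWayne2005, §4.1.3 and Lemma 4.7 (forward twin)] -/
theorem integral_heatKernel_norm_sq_sub_norm_sq_integral_le {C : ℝ}
    {Ω : EuclideanSpace ℝ (Fin 3) → EuclideanSpace ℝ (Fin 3)} (hΩ : ContDiff ℝ 1 Ω)
    (hΩb : ∀ y, ‖Ω y‖ ≤ C) (hDΩb : ∀ y, ‖fderiv ℝ Ω y‖ ≤ C) :
    (∫ y, heatKernel 1 y * ‖Ω y‖ ^ 2) - ‖∫ y, heatKernel 1 y • Ω y‖ ^ 2 ≤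
      2 * ∑ i, ∫ y, heatKernel 1 y * ‖fderiv ℝ (fun z => Ω z i) y‖ ^ 2 := by
  have hΩd : Differentiable ℝ Ω := hΩ.differentiable one_ne_zero
  have hci : ∀ i : Fin 3, ContDiff ℝ 1 (fun z => Ω z i) := fun i =>
    (EuclideanSpace.proj i : EuclideanSpace ℝ (Fin 3) →L[ℝ] ℝ).contDiff.comp hΩ
  have cK : Continuous (heatKernel (E := EuclideanSpace ℝ (Fin 3)) 1) := continuous_heatKernel 1
  -- scalar Poincaré for each component
  have hP : ∀ i : Fin 3, (∫ y, (Ω y i) ^ 2 * heatKernel 1 y) - (∫ y, Ω y i * heatKernel 1 y) ^ 2 ≤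
      2 * 1 * ∫ y, ‖fderiv ℝ (fun z => Ω z i) y‖ ^ 2 * heatKernel 1 y := fun i =>
    sq_integral_heatKernel_poincare one_pos (hci i) (norm_coord_le hΩb i)
      (fun y => (norm_fderiv_coord_le (hΩd y) i).trans (hDΩb y))
  -- `∫ K |Ω|² = Σᵢ ∫ Ωᵢ² K`
  have iSq : ∀ i : Fin 3, Integrable fun y => (Ω y i) ^ 2 * heatKernel 1 y := fun i =>
    integrable_mul_heatKernel one_pos ((hci i).continuous.pow 2) (C := C ^ 2) fun y => by
      rw [Real.norm_eq_abs, abs_pow]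
      have h0 : |Ω y i| ≤ C := by rw [← Real.norm_eq_abs]; exact norm_coord_le hΩb i y
      exact pow_le_pow_left₀ (abs_nonneg _) h0 2
  have hZ : ∫ y, heatKernel 1 y * ‖Ω y‖ ^ 2 = ∑ i, ∫ y, (Ω y i) ^ 2 * heatKernel 1 y := by
    rw [← integral_finsetSum _ fun i _ => iSq i]
    refine integral_congr_ae (Eventually.of_forall fun y => ?_)
    show heatKernel 1 y * ‖Ω y‖ ^ 2 = ∑ i, (Ω y i) ^ 2 * heatKernel 1 y
    rw [EuclideanSpace.norm_sq_eq, mul_comm, Finset.sum_mul]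
    refine Finset.sum_congr rfl fun i _ => ?_
    rw [Real.norm_eq_abs, sq_abs]
  -- `|∫ K Ω|² = Σᵢ (∫ Ωᵢ K)²`
  have iV : Integrable fun y => heatKernel 1 y • Ω y :=
    integrable_of_le_poly_heatKernel (cK.smul hΩ.continuous) (C := C) (N := 0) fun y => by
      rw [norm_smul, Real.norm_eq_abs, abs_of_pos (heatKernel_one_pos y), pow_zero, mul_one, mul_comm]
      exact mul_le_mul_of_nonneg_right (hΩb y) (heatKernel_one_pos y).le
  have hM : ‖∫ y, heatKernel 1 y • Ω y‖ ^ 2 = ∑ i, (∫ y, Ω y i * heatKernel 1 y) ^ 2 := by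
    rw [EuclideanSpace.norm_sq_eq]
    refine Finset.sum_congr rfl fun i _ => ?_
    rw [Real.norm_eq_abs, sq_abs]
    congr 1
    have h := (EuclideanSpace.proj i : EuclideanSpace ℝ (Fin 3) →L[ℝ] ℝ).integral_comp_comm iV
    rw [show (∫ y, heatKernel 1 y • Ω y) i =
        (EuclideanSpace.proj i : EuclideanSpace ℝ (Fin 3) →L[ℝ] ℝ) (∫ y, heatKernel 1 y • Ω y) from rfl, ← h]
    refine integral_congr_ae (Eventually.of_forall fun y => ?_)
    show (heatKernel 1 y • Ω y) i = Ω y i * heatKernel 1 y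
    rw [PiLp.smul_apply, smul_eq_mul, mul_comm]
  rw [hZ, hM, ← Finset.sum_sub_distrib, Finset.mul_sum]
  refine Finset.sum_le_sum fun i _ => ?_
  have := hP i
  rw [mul_one] at this
  refine this.trans (le_of_eq ?_)
  congr 1
  exact integral_congr_ae (Eventually.of_forall fun y => by simp [mul_comm])

end Summit.NavierStokesRegularity.NavierStokesRegularity.Theorems.GaussianGap

end
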